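import Mathlib
import Literature.NumberTheory.Transcendental.GammaIsoCross
import Literature.NumberTheory.Transcendental.ZilberGenericClosedness
import Literature.NumberTheory.Transcendental.PseudoExpVariants
import Literature.NumberTheory.Transcendental.PseudoExpAmbient
import Literature.NumberTheory.Transcendental.GammaFieldsEcl
import Literature.NumberTheory.Transcendental.BKModelGeneric

/-!
# Generic field embeddings over a subfield of `ℂ` (auxiliary file 1 for the stub
`stub_doubleBase` of line `eac-extends-core-automorphisms`, crux stmt-Schanuel-0968)

Pure field theory inside `ℂ`, phrased with the algebraic matroid `GammaField.algMatroid ℂ` of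
`ℂ/ℚ` and the tree's relative rank `Matroid.relRank`:

* `DoubleBase.relRank_union_eq_of_contract_indep` — a matroid lemma: if `I ∪ J` is independent
  in `M ／ C` (`I`, `J` disjoint) then contracting `I` on top of `C` does not lower the rank of any
  `T ⊆ cl(J ∪ C)` ("algebraically disjoint sets do not interact");
* `DoubleBase.countable_acl`, `DoubleBase.exists_not_mem_acl` — the relative algebraic closure of a
  countable subset of `ℂ` is countable, so `ℂ` always has fresh transcendentals;
* `DoubleBase.exists_ringHom_apply_eq` — Steinitz: a subfield `F ⊇ F₀` of `ℂ`, algebraic over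
  `F₀(s)` for an `F₀`-algebraically independent tuple `s`, embeds into `ℂ` over `F₀` with `s ↦ w`
  for any `F₀`-algebraically independent `w` of the same length (`IsFractionRing.liftAlgHom` on
  `Frac F₀[X] ≅ F₀(s)` and `IsAlgClosed.lift`);
* `DoubleBase.mem_acl_image_iff` — field embeddings `F → ℂ` transport relative algebraic closure
  (the algebraic matroid of `F/ℚ` is the `comap` of that of `ℂ` along any embedding);
* `DoubleBase.exists_isGenericEmb` — **generic embeddings**: for subfields `F₀ ≤ F` of `ℂ` with
  `F` countable of finite transcendence degree over `F₀` there is a field embedding `φ : F → ℂ`,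
  the identity on `F₀`, with `φ(F)` *algebraically disjoint from `F` over `F₀`* — contracting `F`
  instead of `F₀` does not lower the relative rank of any subset of `φ(F)`.

Everything here is folklore (Steinitz exchange / algebraic disjointness).
-/

noncomputable section

set_option linter.dupNamespace false

open Set
open scoped Matroid
open Literature.ModelTheory.ExponentialFields Literature.ModelTheory.ExponentialFields.ExponentialRing
open Literature.NumberTheory.Transcendental Literature.NumberTheory.Transcendental.GammaField

namespace Summit.Schanuel.Schanuel.Theorems.RigidCore

namespace DoubleBase

/-! ### A matroid lemma: contracting an algebraically disjoint independent set -/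

/-- **Contracting a set independent from `J` over `C` does not change ranks inside `cl(J ∪ C)`.**
If `I ∪ J` is independent in `M ／ C` with `I ∩ J = ∅`, then for every `T ⊆ M.closure (J ∪ C)`,
`relRank (C ∪ I) T = relRank C T`: a basis `T'` of `T` over `C` stays independent after
contracting `I`, because `I` is independent over `cl(J ∪ C) ⊇ T'`. [folklore] -/
theorem relRank_union_eq_of_contract_indep {α : Type*} (M : Matroid α) {C I J T : Set α}
    (hIJ : (M ／ C).Indep (I ∪ J)) (hdisj : Disjoint I J) (hT : T ⊆ M.closure (J ∪ C)) :
    M.relRank (C ∪ I) T = M.relRank C T := by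
  classical
  refine le_antisymm (M.relRank_anti_left T subset_union_left) ?_
  have h1 : M.relRank (C ∪ I) T = (M ／ C ／ I).eRk T := by
    rw [Matroid.relRank_eq_eRk_contract, Matroid.contract_contract]
  have h2 : M.relRank C T = (M ／ C).eRk T := rfl
  rw [h1, h2]
  obtain ⟨T', hT'⟩ := (M ／ C).exists_isBasis' T
  rw [← hT'.encard_eq_eRk]
  have hI : (M ／ C).Indep I := hIJ.subset subset_union_left
  have hJ : (M ／ C).Indep J := hIJ.subset subset_union_right
  -- `T' ⊆ cl_{M/C} J`
  have hT'cl : T' ⊆ (M ／ C).closure J := by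
    intro t ht
    have htE : t ∈ (M ／ C).E := hT'.indep.subset_ground ht
    have htM : t ∈ M.closure (J ∪ C) := hT (hT'.subset ht)
    rw [Matroid.contract_closure_eq]
    rw [Matroid.contract_ground] at htE
    exact ⟨htM, htE.2⟩
  -- `I` is independent in `M ／ C ／ cl J`
  have hIclJ : (M ／ C ／ (M ／ C).closure J).Indep I := by
    rw [Matroid.contract_closure_eq_contract_delete, Matroid.delete_indep_iff,
      hJ.contract_indep_iff]
    refine ⟨⟨hdisj, hIJ⟩, ?_⟩
    rw [Set.disjoint_left]
    rintro x hxI ⟨hxcl, hxJ⟩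
    have hx := ((hJ.mem_closure_iff').1 hxcl).2
      (hIJ.subset (insert_subset (Or.inl hxI) subset_union_right))
    exact hxJ hx
  -- hence in `M ／ C ／ T'`, so `T' ∪ I` is independent in `M ／ C`
  have hIT' : (M ／ C ／ T').Indep I := by
    have heq : M ／ C ／ T' ／ ((M ／ C).closure J \ T') = M ／ C ／ (M ／ C).closure J := by
      rw [Matroid.contract_contract (M ／ C) T', Set.union_sdiff_cancel hT'cl]
    rw [← heq] at hIclJ
    exact hIclJ.of_contract
  rw [hT'.indep.contract_indep_iff] at hIT'
  have hT'I : (M ／ C ／ I).Indep T' := by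
    rw [hI.contract_indep_iff]
    refine ⟨hIT'.1.symm, ?_⟩
    rw [union_comm]
    exact hIT'.2
  calc T'.encard = (M ／ C ／ I).eRk T' := hT'I.eRk_eq_encard.symm
    _ ≤ (M ／ C ／ I).eRk T := (M ／ C ／ I).eRk_mono hT'.subset

/-! ### Countability of relative algebraic closures in `ℂ`; fresh transcendentals -/

/-- The relative algebraic closure `acl C` of a countable `C ⊆ ℂ` is countable (it lies in the
algebraic closure of the countable field `ℚ(C)`). [folklore] -/
theorem countable_acl {C : Set ℂ} (hC : C.Countable) : (acl C).Countable := by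
  set K₀ : IntermediateField ℚ ℂ := IntermediateField.adjoin ℚ C with hK₀def
  have h1 : acl C = acl (K₀ : Set ℂ) := (acl_adjoin C).symm
  have hK₀ : Cardinal.mk K₀ ≤ Cardinal.aleph0 := by
    have e1 : ((K₀ : IntermediateField ℚ ℂ) : Set ℂ) =
        Subfield.closure (Set.range (algebraMap ℚ ℂ) ∪ C) := by
      rw [← IntermediateField.coe_toSubfield, hK₀def, IntermediateField.adjoin_toSubfield]
    have e2 : Cardinal.mk K₀ = Cardinal.mk (Subfield.closure (Set.range (algebraMap ℚ ℂ) ∪ C)) :=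
      Cardinal.mk_congr (Equiv.setCongr e1)
    rw [e2]
    refine le_trans (Subfield.cardinalMk_closure_le_max _) (max_le ?_ le_rfl)
    rw [Cardinal.mk_le_aleph0_iff]
    exact ((countable_range _).union hC).to_subtype
  have h2 : Countable (algebraicClosure K₀ ℂ).toSubfield := PseudoExpAmbient.countable_amb K₀ hK₀
  have h3 : acl (K₀ : Set ℂ) ⊆ ((algebraicClosure K₀ ℂ).toSubfield : Set ℂ) :=
    PseudoExpAmbient.acl_subset_amb K₀
  have h4 : (((algebraicClosure K₀ ℂ).toSubfield : Subfield ℂ) : Set ℂ).Countable :=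
    Set.countable_coe_iff.1 h2
  rw [h1]
  exact h4.mono h3

/-- Over a countable `C ⊆ ℂ` and finitely many further elements there is always a fresh
transcendental (`ℂ` is uncountable). [folklore] -/
theorem exists_not_mem_acl {C : Set ℂ} (hC : C.Countable) (T : Set ℂ) (hT : T.Finite) :
    ∃ w, w ∉ acl (C ∪ T) := by
  by_contra h
  push Not at h
  exact not_countable_complex ((countable_acl (hC.union hT.countable)).mono fun x _ => h x)

/-! ### Algebraicity over `F₀[S]` and the relative algebraic closure -/

/-- An element of `ℂ` algebraic over the subalgebra `F₀[S]` (`F₀ ≤ ℂ` a subfield) lies in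
`acl (F₀ ∪ S)`. [folklore] -/
theorem mem_acl_of_isAlgebraic_adjoin (F₀ : IntermediateField ℚ ℂ) {S : Set ℂ} {a : ℂ}
    (h : IsAlgebraic (Algebra.adjoin F₀ S) a) : a ∈ acl ((F₀ : Set ℂ) ∪ S) := by
  obtain ⟨E, hE, hflat⟩ := exists_subalgebra_eq_acl ((F₀ : Set ℂ) ∪ S)
  set R₀ : Subalgebra F₀ ℂ := Algebra.adjoin F₀ S with hR₀
  -- `F₀[S] ⊆ E`
  have hle : ∀ x : R₀, (x : ℂ) ∈ E := by
    intro x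
    have hx : (x : ℂ) ∈ R₀ := x.2
    rw [← SetLike.mem_coe, hE]
    refine Algebra.adjoin_induction (fun y hy => ?_) (fun r => ?_)
      (fun _ _ _ _ => add_mem_acl) (fun _ _ _ _ => mul_mem_acl) hx
    · exact subset_acl _ (Or.inr hy)
    · exact subset_acl _ (Or.inl r.2)
  let ι : R₀ →+* E := (algebraMap R₀ ℂ).codRestrict E hle
  letI : Algebra R₀ E := ι.toAlgebra
  haveI : IsScalarTower R₀ E ℂ := IsScalarTower.of_algebraMap_eq fun x => rfl
  have hinj : Function.Injective (algebraMap R₀ E) := by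
    intro x y hxy
    have : (ι x : ℂ) = ι y := congrArg Subtype.val hxy
    exact Subtype.ext this
  exact hflat a (h.extendScalars hinj)

/-! ### Steinitz: embeddings with prescribed values on a transcendence basis -/

/-- **Embedding over `F₀` with prescribed values on a transcendence basis** (Steinitz). Let
`F₀ ≤ F ≤ ℂ` be subfields, `s` an `F₀`-algebraically independent tuple in `F` over which `F` is
algebraic, and `w` an `F₀`-algebraically independent tuple in `ℂ` of the same length. Then there
is a field embedding `φ : F → ℂ` which is the identity on `F₀` and sends `sᵢ ↦ wᵢ`: compose
`F₀(s) ≅ Frac F₀[X] → ℂ`, `Xᵢ ↦ wᵢ`, with `IsAlgClosed.lift` along the algebraic extension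
`F / F₀(s)`. [folklore] -/
theorem exists_ringHom_apply_eq (F₀ F : IntermediateField ℚ ℂ) (hle : F₀ ≤ F) {d : ℕ}
    {s : Fin d → ℂ} (hsF : ∀ i, s i ∈ F) (hs : AlgebraicIndependent F₀ s)
    (halg : ∀ a ∈ F, IsAlgebraic (Algebra.adjoin F₀ (range s)) a)
    {w : Fin d → ℂ} (hw : AlgebraicIndependent F₀ w) :
    ∃ φ : F →+* ℂ, (∀ (x : ℂ) (hx : x ∈ F), x ∈ F₀ → φ ⟨x, hx⟩ = x) ∧
      ∀ i, φ ⟨s i, hsF i⟩ = w i := by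
  classical
  set P := MvPolynomial (Fin d) F₀ with hP
  set Q := FractionRing P with hQ
  have hinj₁ : Function.Injective (MvPolynomial.aeval s : P →ₐ[F₀] ℂ) :=
    algebraicIndependent_iff_injective_aeval.1 hs
  have hinj₂ : Function.Injective (MvPolynomial.aeval w : P →ₐ[F₀] ℂ) :=
    algebraicIndependent_iff_injective_aeval.1 hw
  let ι₁ : Q →ₐ[F₀] ℂ := IsFractionRing.liftAlgHom hinj₁
  let ι₂ : Q →ₐ[F₀] ℂ := IsFractionRing.liftAlgHom hinj₂
  have hι₁_alg : ∀ p : P, ι₁ (algebraMap P Q p) = MvPolynomial.aeval s p := fun p => by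
    change IsFractionRing.lift hinj₁ (algebraMap P Q p) = _
    exact IsFractionRing.lift_algebraMap hinj₁ p
  have hι₂_alg : ∀ p : P, ι₂ (algebraMap P Q p) = MvPolynomial.aeval w p := fun p => by
    change IsFractionRing.lift hinj₂ (algebraMap P Q p) = _
    exact IsFractionRing.lift_algebraMap hinj₂ p
  -- the image of `ι₁` lies in `F`
  have haevalF : ∀ p : P, MvPolynomial.aeval s p ∈ F := by
    intro p
    have hmem : MvPolynomial.aeval s p ∈ Algebra.adjoin F₀ (range s) := by
      rw [Algebra.adjoin_range_eq_range_aeval]; exact ⟨p, rfl⟩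
    have hsub : Algebra.adjoin F₀ (range s) ≤ (IntermediateField.extendScalars hle).toSubalgebra :=
      Algebra.adjoin_le (by rintro _ ⟨i, rfl⟩; exact hsF i)
    exact (IntermediateField.mem_extendScalars hle).1 (hsub hmem)
  have hι₁F : ∀ q : Q, ι₁ q ∈ F := by
    intro q
    obtain ⟨a, b, _, rfl⟩ := IsFractionRing.div_surjective (A := P) q
    rw [map_div₀, hι₁_alg, hι₁_alg]
    exact div_mem (haevalF a) (haevalF b)
  -- `F` as a `Q`-algebra through `ι₁`, `ℂ` as a `Q`-algebra through `ι₂`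
  let j₁ : Q →+* F := (ι₁ : Q →+* ℂ).codRestrict F hι₁F
  letI algQF : Algebra Q F := j₁.toAlgebra
  letI algQC : Algebra Q ℂ := (ι₂ : Q →+* ℂ).toAlgebra
  have halgQF : ∀ q : Q, ((algebraMap Q F q : F) : ℂ) = ι₁ q := fun q => rfl
  have halgQC : ∀ q : Q, algebraMap Q ℂ q = ι₂ q := fun q => rfl
  have htfQC : Module.IsTorsionFree Q ℂ :=
    Module.isTorsionFree_iff_algebraMap_injective.2 (ι₂ : Q →+* ℂ).injective
  have htfQF : Module.IsTorsionFree Q F :=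
    Module.isTorsionFree_iff_algebraMap_injective.2 j₁.injective
  -- `F` is algebraic over `Q`: transport polynomials along `F₀[s] ≅ F₀[X] → Q`
  let R₀ : Subalgebra F₀ ℂ := Algebra.adjoin F₀ (range s)
  let e₀ : P ≃ₐ[F₀] R₀ := hs.aevalEquiv
  let jR : R₀ →+* Q := (algebraMap P Q).comp (e₀.symm : R₀ →ₐ[F₀] P).toRingHom
  have hjR : ∀ r : R₀, ι₁ (jR r) = r := by
    intro r
    change ι₁ (algebraMap P Q (e₀.symm r)) = r
    rw [hι₁_alg, ← hs.algebraMap_aevalEquiv, AlgEquiv.apply_symm_apply]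
    rfl
  have hjRinj : Function.Injective jR := by
    intro x y hxy
    have := congrArg ι₁ hxy
    rw [hjR, hjR] at this
    exact Subtype.ext this
  haveI : Algebra.IsAlgebraic Q F := by
    refine ⟨fun a => ?_⟩
    obtain ⟨p₀, hp₀, hp₀a⟩ := halg a a.2
    refine ⟨p₀.map jR, (Polynomial.map_ne_zero_iff hjRinj).2 hp₀, ?_⟩
    apply Subtype.val_injective
    change ((Polynomial.aeval a (p₀.map jR) : F) : ℂ) = ((0 : F) : ℂ)
    rw [Polynomial.aeval_def, Polynomial.eval₂_map,
      show ((Polynomial.eval₂ ((algebraMap Q F).comp jR) a p₀ : F) : ℂ) =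
        Polynomial.eval₂ ((algebraMap F ℂ).comp ((algebraMap Q F).comp jR)) (a : ℂ) p₀ from
        Polynomial.hom_eval₂ p₀ _ (algebraMap F ℂ) a]
    have hcomp : (algebraMap F ℂ).comp ((algebraMap Q F).comp jR) = algebraMap R₀ ℂ := by
      ext r
      change (((algebraMap Q F) (jR r) : F) : ℂ) = r
      rw [halgQF, hjR]
    rw [hcomp, ← Polynomial.aeval_def, hp₀a]
    rfl
  -- the lift
  let ψ : F →ₐ[Q] ℂ := IsAlgClosed.lift
  refine ⟨ψ.toRingHom, fun x hx hx₀ => ?_, fun i => ?_⟩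
  · have hx' : (⟨x, hx⟩ : F) = algebraMap Q F (algebraMap F₀ Q ⟨x, hx₀⟩) := by
      apply Subtype.ext
      change x = ((algebraMap Q F (algebraMap F₀ Q ⟨x, hx₀⟩) : F) : ℂ)
      rw [halgQF, AlgHom.commutes]
      rfl
    change ψ ⟨x, hx⟩ = x
    rw [hx', ψ.commutes, halgQC, AlgHom.commutes]
    rfl
  · have hx' : (⟨s i, hsF i⟩ : F) = algebraMap Q F (algebraMap P Q (MvPolynomial.X i)) := by
      apply Subtype.ext
      change s i = ((algebraMap Q F (algebraMap P Q (MvPolynomial.X i)) : F) : ℂ)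
      rw [halgQF, hι₁_alg, MvPolynomial.aeval_X]
    change ψ ⟨s i, hsF i⟩ = w i
    rw [hx', ψ.commutes, halgQC, hι₂_alg, MvPolynomial.aeval_X]

/-! ### Generic embeddings -/

/-- **Field embeddings transport relative algebraic closure**: for a subfield `F ≤ ℂ`, a field
embedding `φ : F → ℂ`, `A ⊆ F` and `x ∈ F`, `x ∈ acl A ↔ φ x ∈ acl (φ A)` (both sides are
`x ∈ cl A` in the algebraic matroid of `F/ℚ`, which is the `comap` of that of `ℂ` along either
embedding). [folklore] -/
theorem mem_acl_image_iff (F : IntermediateField ℚ ℂ) (φ : F →+* ℂ) (A : Set F) (x : F) :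
    (x : ℂ) ∈ acl (((↑) : F → ℂ) '' A) ↔ φ x ∈ acl (φ '' A) := by
  have h1 := MatroidComap.algebraicIndependent_matroid_eq_comap (algebraMap F ℂ)
    (algebraMap F ℂ).injective
  have h2 := MatroidComap.algebraicIndependent_matroid_eq_comap φ φ.injective
  have h12 : (algMatroid ℂ).comap (algebraMap F ℂ) = (algMatroid ℂ).comap φ := h1.symm.trans h2
  have key : (algebraMap F ℂ) ⁻¹' (algMatroid ℂ).closure ((algebraMap F ℂ) '' A) =
      φ ⁻¹' (algMatroid ℂ).closure (φ '' A) := by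
    have := congrArg (fun N : Matroid F => N.closure A) h12
    simpa only [Matroid.comap_closure_eq] using this
  change x ∈ (algebraMap F ℂ) ⁻¹' (algMatroid ℂ).closure ((algebraMap F ℂ) '' A) ↔
    x ∈ φ ⁻¹' (algMatroid ℂ).closure (φ '' A)
  rw [key]

/-- **Generic embeddings exist** for subfields `F₀ ≤ F` of `ℂ` with `F` countable and of finite
transcendence degree over `F₀`: choose an `F₀`-transcendence basis `s` of `F` (finite), a tuple
`w` of the same length of elements successively transcendental over `F` and everything chosen so
far (`ℂ` is uncountable), and the Steinitz embedding `s ↦ w` over `F₀`; algebraic disjointness is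
the matroid lemma `relRank_union_eq_of_contract_indep` applied to the independent set `s ∪ w`
over `F₀`. [folklore] -/
theorem exists_isGenericEmb (F₀ F : IntermediateField ℚ ℂ) (hle : F₀ ≤ F)
    (hfin : (algMatroid ℂ).relRank (F₀ : Set ℂ) (F : Set ℂ) < ⊤)
    (hcount : (F : Set ℂ).Countable) :
    ∃ φ : F →+* ℂ, (∀ (x : ℂ) (hx : x ∈ F), x ∈ F₀ → φ ⟨x, hx⟩ = x) ∧
      ∀ S : Set F, (algMatroid ℂ).relRank (F : Set ℂ) (φ '' S) =
        (algMatroid ℂ).relRank (F₀ : Set ℂ) (φ '' S) := by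
  classical
  -- an `F₀`-transcendence basis of `F`, chosen in the algebraic matroid of `ℂ/F₀`; it is finite
  obtain ⟨s₀, hs₀⟩ := (AlgebraicIndependent.matroid F₀ ℂ).exists_isBasis (F : Set ℂ)
  obtain ⟨hind₀, hsub, halg⟩ := AlgebraicIndependent.matroid_isBasis_iff.1 hs₀
  have hS₀ : ((algMatroid ℂ) ／ (F₀ : Set ℂ)).Indep s₀ := contract_indep_of_algebraicIndepOn F₀ hind₀
  have hfinS : s₀.Finite := by
    rw [← Set.encard_lt_top_iff]
    exact lt_of_le_of_lt (hS₀.encard_le_eRk_of_subset hsub) hfin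
  obtain ⟨d, f, hf⟩ := hfinS.fin_embedding
  have hsF : ∀ i, f i ∈ F := fun i => hsub (hf ▸ mem_range_self i)
  have hs : AlgebraicIndependent F₀ (f : Fin d → ℂ) := by
    rw [← algebraicIndependent_subtype_range f.injective, hf]
    exact hind₀
  have halg' : ∀ a ∈ F, IsAlgebraic (Algebra.adjoin F₀ (range f)) a := by
    rw [hf]; exact halg
  have hSf : ((algMatroid ℂ) ／ (F₀ : Set ℂ)).Indep (range f) := by rw [hf]; exact hS₀
  -- fresh transcendentals over `F` and the Steinitz embedding
  obtain ⟨w, hw⟩ := BKModel.exists_fresh_tuple (fun T hT => exists_not_mem_acl hcount T hT) d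
  have hwF : AlgebraicIndependent F w :=
    algebraicIndependent_of_forall_not_mem_acl F (subset_acl _) w hw
  have hw₀ : AlgebraicIndependent F₀ w :=
    algebraicIndependent_of_forall_not_mem_acl F₀ (fun x hx => subset_acl _ (hle hx)) w hw
  obtain ⟨φ, hfix, hφs⟩ := exists_ringHom_apply_eq F₀ F hle hsF hs halg' hw₀
  refine ⟨φ, hfix, fun S => ?_⟩
  -- `range f ∪ range w` is independent over `F₀`
  have hsubU : (F₀ : Set ℂ) ∪ range f ⊆ F :=
    union_subset hle (by rintro _ ⟨i, rfl⟩; exact hsF i)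
  have hT₀F : ((algMatroid ℂ) ／ (F : Set ℂ)).Indep (range w) :=
    contract_indep_of_algebraicIndepOn F hwF.to_subtype_range
  have hT₀ : ((algMatroid ℂ) ／ (F₀ : Set ℂ) ／ range f).Indep (range w) := by
    have heq : (algMatroid ℂ) ／ (F : Set ℂ) =
        (algMatroid ℂ) ／ (F₀ : Set ℂ) ／ range f ／ (F : Set ℂ) := by
      rw [Matroid.contract_contract, Matroid.contract_contract, ← union_assoc,
        union_eq_right.2 hsubU]
    rw [heq] at hT₀F
    exact hT₀F.of_contract
  rw [hSf.contract_indep_iff] at hT₀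
  -- `cl F = cl (F₀ ∪ range f)` and `φ '' S ⊆ cl (range w ∪ F₀)`
  have hFcl : (F : Set ℂ) ⊆ (algMatroid ℂ).closure ((F₀ : Set ℂ) ∪ range f) := fun a ha =>
    mem_acl_of_isAlgebraic_adjoin F₀ (halg' a ha)
  have hcl : (algMatroid ℂ).closure (F : Set ℂ) = (algMatroid ℂ).closure ((F₀ : Set ℂ) ∪ range f) :=
    Subset.antisymm ((algMatroid ℂ).closure_subset_closure_of_subset_closure hFcl)
      ((algMatroid ℂ).closure_subset_closure hsubU)
  have hTS : φ '' S ⊆ (algMatroid ℂ).closure (range w ∪ (F₀ : Set ℂ)) := by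
    rintro _ ⟨x, _, rfl⟩
    set A : Set F := ((↑) : F → ℂ) ⁻¹' ((F₀ : Set ℂ) ∪ range f) with hA
    have hxA : (x : ℂ) ∈ acl (((↑) : F → ℂ) '' A) := by
      have hAeq : ((↑) : F → ℂ) '' A = (F₀ : Set ℂ) ∪ range f := by
        ext z
        constructor
        · rintro ⟨y, hy, rfl⟩; exact hy
        · intro hz; exact ⟨⟨z, hsubU hz⟩, hz, rfl⟩
      rw [hAeq]
      exact hFcl x.2
    refine acl_mono ?_ ((mem_acl_image_iff F φ A x).1 hxA)
    rintro _ ⟨z, hz, rfl⟩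
    rcases hz with hz | ⟨i, hi⟩
    · refine Or.inr ?_
      rw [hfix z z.2 hz]
      exact hz
    · refine Or.inl ⟨i, ?_⟩
      rw [← hφs i]
      congr 1
      exact Subtype.ext hi
  calc (algMatroid ℂ).relRank (F : Set ℂ) (φ '' S)
      = (algMatroid ℂ).relRank ((F₀ : Set ℂ) ∪ range f) (φ '' S) :=
        (algMatroid ℂ).relRank_congr_closure_left _ hcl
    _ = (algMatroid ℂ).relRank (F₀ : Set ℂ) (φ '' S) :=
        relRank_union_eq_of_contract_indep (algMatroid ℂ) (I := range f) (J := range w)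
          (by rw [union_comm]; exact hT₀.2) hT₀.1.symm hTS

end DoubleBase


/-- **Registered sub-goal of `stub_doubleBase` (auxiliary file 1): generic embeddings exist** —
`DoubleBase.exists_isGenericEmb` restated at the stub namespace. -/
theorem doubleBase_exists_genericEmb (F₀ F : IntermediateField ℚ ℂ) (hle : F₀ ≤ F)
    (hfin : (algMatroid ℂ).relRank (F₀ : Set ℂ) (F : Set ℂ) < ⊤) (hcount : (F : Set ℂ).Countable) :
    ∃ φ : F →+* ℂ, (∀ (x : ℂ) (hx : x ∈ F), x ∈ F₀ → φ ⟨x, hx⟩ = x) ∧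
      ∀ S : Set F, (algMatroid ℂ).relRank (F : Set ℂ) (φ '' S) =
        (algMatroid ℂ).relRank (F₀ : Set ℂ) (φ '' S) :=
  DoubleBase.exists_isGenericEmb F₀ F hle hfin hcount

end Summit.Schanuel.Schanuel.Theorems.RigidCore
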